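import Literature.NumberTheory.Transcendental.KZSubcalculusInvariants
import Summits.KontsevichZagierPeriods.KontsevichZagierPeriods.Theorems.ValuedFieldSpecialisationCTConstructionDilateMap
import Summits.KontsevichZagierPeriods.KontsevichZagierPeriods.Theorems.ValuedFieldSpecialisationClassLevelExpansionFibreDimOneElementaryA

/-!
# Route ValuedFieldSpecialisation — crux `CTConstruction`: dilating a typed elementary family

Helper toward crux stmt-KontsevichZagierPeriods-3495 (`CTConstruction`), line `registered`, stub
`stub_dilate_typedElementary` of the lead's "dilation elimination". A **typed elementary family**
`R : KZ.IntegralRep (B + d + 2)` has coordinates `z = (s, u, t, w)` (`s = z 0` the parameter,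
`u = z 1`, the typed block `t : Fin B → ℝ`, `w : Fin d → ℝ`), domain `0 < s < 1`, `0 < u`,
`u ^ Q * s ^ p < 1`, `κ j * s ^ (e j) ≤ t j ≤ 1`, `w ∈ r.domain`, and integrand
`∏ (t j)⁻¹ * r.integrand w`. The Jacobian-free dilate of the parameter by a rational `0 < μ ≤ 1`,
restricted to the slab `0 < s < 1`, is the representation `R'` with
`R'.domain = D_μ⁻¹(R.domain) ∩ {0 < z 0 < 1}`, `R'.integrand = R.integrand ∘ D_μ`
(`D_μ z = update z 0 (μ * z 0)`). For a natural `c > 0` with `c ^ Q * μ ^ p = 1` we show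
`[R'] - c • [R''] ∈ KZ.fibredRelations`, where `R''` is the typed family with lower-bound
coefficients `κ j * μ ^ (e j)`:

* the FIBRED change of variables `Φ z = update z 1 (c⁻¹ * z 1)` (linear, fixes `z 0`,
  `|det Φ'| = c⁻¹`) maps `R'.domain` onto `R''.domain` (because `(c u)^Q (μ s)^p = u^Q s^p`), and
  the typed integrand only reads the coordinates `≥ 2`, so `[R'] - [R''.constMul c]` is a fibred
  change of variables;
* `[R''.constMul c] - c • [R'']` lies in the closure of the integrand-additivity instances
  (`KZ.IntegralRep.of_constMul_nat_sub_nsmul_mem`), all of which are fibred generators.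

The representation `R''` is CONSTRUCTED by transport of structure from `R'` through the linear
automorphism `z ↦ update z 1 (c * z 1)` (preimage of a semialgebraic set under a polynomial map,
composite of a semialgebraic function with a polynomial map, `L_* vol = |det L|⁻¹ • vol`).

Sources: M. Kontsevich, D. Zagier, *Periods* (2001), §1.2 (rules (1)–(2)); J. Bochnak, M. Coste,
M.-F. Roy, *Real Algebraic Geometry* (1998), §2.2 (Prop. 2.2.6). No new definitions.
-/

noncomputable section

namespace Summit.KontsevichZagierPeriods.ValuedFieldSpecialisation

open MeasureTheory Set Filter MvPolynomial
open Literature.NumberTheory.Transcendental Literature.NumberTheory.Transcendental.KZ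
open Literature.ModelTheory.ExponentialFields (IsSemialgebraic isSemialgebraic_univ)

/-! ## Coordinates of a typed elementary family -/

/-- An index `k + 2` of `Fin (n + 2)` is not the parameter index `0`. [folklore] -/
theorem succ_succ_ne_zero {n : ℕ} (k : Fin n) : k.succ.succ ≠ (0 : Fin (n + 1 + 1)) :=
  Fin.succ_ne_zero _

/-- An index `k + 2` of `Fin (n + 2)` is not the index `1`. [folklore] -/
theorem succ_succ_ne_one {n : ℕ} (k : Fin n) : k.succ.succ ≠ (1 : Fin (n + 1 + 1)) := fun h =>
  Fin.succ_ne_zero k (Fin.succ_inj.mp (h.trans Fin.succ_zero_eq_one.symm))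

/-- The typed integrand `∏ (t j)⁻¹ * r.integrand w` only reads the coordinates `≥ 2`: it is
unchanged by updating a coordinate `i ∉ {k + 2}`. [folklore] -/
theorem typedIntegrand_update {B d : ℕ} (ρ : IntegralRep d) {i : Fin (B + d + 1 + 1)}
    (hi : ∀ k : Fin (B + d), k.succ.succ ≠ i) (z : Fin (B + d + 1 + 1) → ℝ) (a : ℝ) :
    (∏ j : Fin B, (Function.update z i a (Fin.castAdd d j).succ.succ)⁻¹) *
        ρ.integrand (fun l : Fin d => Function.update z i a (Fin.natAdd B l).succ.succ) =
      (∏ j : Fin B, (z (Fin.castAdd d j).succ.succ)⁻¹) *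
        ρ.integrand (fun l : Fin d => z (Fin.natAdd B l).succ.succ) := by
  simp only [Function.update_of_ne (hi _)]

/-- The `∃`-description of the domain of a typed elementary family (lower bounds
`a j * s ^ (e j) ≤ t j`) agrees with its coordinate description (pattern of
`elementaryDomain_eq`). [folklore] -/
theorem typedDomain_eq {d : ℕ} (Q p B : ℕ) (a : Fin B → ℝ) (e : Fin B → ℕ) (ρ : IntegralRep d) :
    {z : Fin (B + d + 1 + 1) → ℝ | ∃ (s u : ℝ) (t : Fin B → ℝ) (w : Fin d → ℝ),
      z = Matrix.vecCons s (Matrix.vecCons u (Fin.append t w)) ∧ 0 < s ∧ s < 1 ∧ 0 < u ∧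
        u ^ Q * s ^ p < 1 ∧ (∀ j, a j * s ^ (e j) ≤ t j ∧ t j ≤ 1) ∧ w ∈ ρ.domain} =
    {z | 0 < z 0 ∧ z 0 < 1 ∧ 0 < z 1 ∧ z 1 ^ Q * z 0 ^ p < 1 ∧
      (∀ j : Fin B, a j * z 0 ^ (e j) ≤ z (Fin.castAdd d j).succ.succ ∧
        z (Fin.castAdd d j).succ.succ ≤ 1) ∧
      (fun l : Fin d => z (Fin.natAdd B l).succ.succ) ∈ ρ.domain} := by
  ext z
  simp only [mem_setOf_eq]
  constructor
  · rintro ⟨s, u, t, w, rfl, hs, hs1, hu, huq, ht, hw⟩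
    refine ⟨by simpa using hs, by simpa using hs1, by simpa using hu, by simpa using huq,
      fun j => by simpa using ht j, by simpa using hw⟩
  · rintro ⟨hs, hs1, hu, huq, ht, hw⟩
    exact ⟨z 0, z 1, _, _, (vecCons_vecCons_append_eq z).symm, hs, hs1, hu, huq, ht, hw⟩

/-! ## Scaling one coordinate: the linear automorphism `z ↦ update z i (c * z i)` -/

/-- Scaling the coordinate `i` by `c ≠ 0` is a continuous linear automorphism of `ℝⁿ` with
inverse the scaling by `c⁻¹` and determinant `c` (a diagonal matrix). [folklore] -/
theorem exists_scaleEquiv (n : ℕ) (i : Fin n) {c : ℝ} (hc : c ≠ 0) :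
    ∃ L : (Fin n → ℝ) ≃L[ℝ] (Fin n → ℝ),
      (∀ z, L z = Function.update z i (c * z i)) ∧
        (∀ z, L.symm z = Function.update z i (c⁻¹ * z i)) ∧
          (L : (Fin n → ℝ) →L[ℝ] (Fin n → ℝ)).det = c := by
  let e : (Fin n → ℝ) ≃ₗ[ℝ] (Fin n → ℝ) :=
    { toFun := fun z => Function.update z i (c * z i)
      invFun := fun z => Function.update z i (c⁻¹ * z i)
      map_add' := fun x y => by
        ext k; by_cases hk : k = i <;> simp [mul_add, hk]
      map_smul' := fun a x => by
        ext k; by_cases hk : k = i <;> simp [mul_left_comm, hk]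
      left_inv := fun z => by
        ext k; by_cases hk : k = i <;> simp [hk, hc]
      right_inv := fun z => by
        ext k; by_cases hk : k = i <;> simp [hk, hc] }
  refine ⟨e.toContinuousLinearEquiv, fun z => rfl, fun z => rfl, ?_⟩
  have hM : LinearMap.toMatrix' (e : (Fin n → ℝ) →ₗ[ℝ] (Fin n → ℝ)) =
      Matrix.diagonal (Function.update (fun _ : Fin n => (1 : ℝ)) i c) := by
    ext k l
    rw [LinearMap.toMatrix'_apply, Matrix.diagonal_apply]
    change Function.update (Pi.single l (1 : ℝ) : Fin n → ℝ) i
      (c * (Pi.single l (1 : ℝ) : Fin n → ℝ) i) k = _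
    simp only [Function.update_apply, Pi.single_apply]
    split_ifs <;> simp_all
  show LinearMap.det (e : (Fin n → ℝ) →ₗ[ℝ] (Fin n → ℝ)) = c
  rw [← LinearMap.det_toMatrix', hM, Matrix.det_diagonal,
    Finset.prod_update_of_mem (Finset.mem_univ i)]
  simp

/-- **Linear change of variables for integrability**: if `f` is integrable on `σ` then `f ∘ L`
is integrable on `L ⁻¹' σ` for a continuous linear automorphism `L` of `ℝⁿ`
(`L_* vol = |det L|⁻¹ • vol`, `MeasureTheory.Measure.map_linearMap_addHaar_eq_smul_addHaar`,
`MeasurableEmbedding.integrableOn_map_iff`). [folklore] -/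
theorem integrableOn_comp_equiv_preimage {n : ℕ} (L : (Fin n → ℝ) ≃L[ℝ] (Fin n → ℝ))
    {f : (Fin n → ℝ) → ℝ} {σ : Set (Fin n → ℝ)} (hf : IntegrableOn f σ volume) :
    IntegrableOn (f ∘ ⇑L) (⇑L ⁻¹' σ) volume := by
  have hmap := Measure.map_linearMap_addHaar_eq_smul_addHaar
    (volume : Measure (Fin n → ℝ)) (LinearEquiv.isUnit_det' L.toLinearEquiv).ne_zero
  have hcoe : ⇑L.toLinearEquiv.toLinearMap = ⇑L := rfl
  have h1 : IntegrableOn f σ (Measure.map (⇑L) volume) := by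
    rw [← hcoe, hmap, IntegrableOn, Measure.restrict_smul]
    exact hf.integrable.smul_measure ENNReal.ofReal_ne_top
  have hemb : MeasurableEmbedding (⇑L) := by
    simpa only [ContinuousLinearEquiv.coe_toHomeomorph] using L.toHomeomorph.measurableEmbedding
  exact hemb.integrableOn_map_iff.mp h1

/-- Scaling the coordinate `i` by a rational `q` is the polynomial map with coordinates
`update X i (C q * X i)`. [folklore] -/
theorem aeval_scalePoly {n : ℕ} (i : Fin n) (q : ℚ) (z : Fin n → ℝ) (j : Fin n) :
    aeval z (Function.update (fun k : Fin n => (X k : MvPolynomial (Fin n) ℚ)) i (C q * X i) j) =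
      Function.update z i ((q : ℝ) * z i) j := by
  rcases eq_or_ne j i with rfl | hj
  · simp
  · simp [hj]

/-- Scaling the coordinate `i` by a rational `q` is a `ℚ`-semialgebraic map on every
`ℚ`-semialgebraic set (`isSemialgebraicMapOn_aeval`). [Bochnak–Coste–Roy 1998, §2.2] [folklore] -/
theorem isSemialgebraicMapOn_scale {n : ℕ} {σ : Set (Fin n → ℝ)} (hσ : IsSemialgebraic ℚ σ)
    (i : Fin n) (q : ℚ) :
    IsSemialgebraicMapOn ℚ σ (fun z : Fin n → ℝ => Function.update z i ((q : ℝ) * z i)) :=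
  (isSemialgebraicMapOn_aeval hσ _).congr fun z _ => funext (aeval_scalePoly i q z)

/-- The preimage of a `ℚ`-semialgebraic set under the scaling of the coordinate `i` by a
rational `q` is `ℚ`-semialgebraic (`IsSemialgebraic.preimage_aeval`).
[Bochnak–Coste–Roy 1998, §2.1] [folklore] -/
theorem isSemialgebraic_setOf_scale_mem {n : ℕ} {σ : Set (Fin n → ℝ)} (hσ : IsSemialgebraic ℚ σ)
    (i : Fin n) (q : ℚ) :
    IsSemialgebraic ℚ {z : Fin n → ℝ | Function.update z i ((q : ℝ) * z i) ∈ σ} := by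
  have h := hσ.preimage_aeval
    (Function.update (fun k : Fin n => (X k : MvPolynomial (Fin n) ℚ)) i (C q * X i))
  have hD : (fun (x : Fin n → ℝ) (j : Fin n) => aeval x
      (Function.update (fun k : Fin n => (X k : MvPolynomial (Fin n) ℚ)) i (C q * X i) j)) =
        fun z => Function.update z i ((q : ℝ) * z i) :=
    funext fun z => funext (aeval_scalePoly i q z)
  rw [hD] at h
  exact h

/-! ## Dividing the coordinate `1` by a natural `c`, fibrewise in the parameter -/

/-- Integer multiples inside the fibred calculus: `[σ, c f] - c • [σ, f] ∈ fibredRelations`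
(it lies in the closure of the integrand-additivity instances,
`KZ.IntegralRep.of_constMul_nat_sub_nsmul_mem`, which are fibred generators).
[Kontsevich–Zagier 2001, §1.2 rule (1)] [folklore] -/
theorem of_constMul_nat_sub_nsmul_mem_fibredRelations {n : ℕ} (S : IntegralRep n) (c : ℕ) :
    of (S.constMul (c : ℝ) (isAlgebraic_nat c)) - c • of S ∈ fibredRelations :=
  (AddSubgroup.closure_mono integrandAddRel_subset_fibredGenerators)
    (S.of_constMul_nat_sub_nsmul_mem c)

/-- **Transport through `u ↦ u / c`.** Let `R'` be a family in dimension `N + 2` whose integrand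
is (everywhere) a function `f` not reading the coordinate `1`, and let `c > 0` be a natural number.
Then the set `D'' = {z | update z 1 (c * z 1) ∈ R'.domain}` carries a representation `R''` with
integrand `f`, and `[R'] - c • [R''] ∈ fibredRelations`: the substitution
`Φ z = update z 1 (c⁻¹ * z 1)` (linear, `Φ z 0 = z 0`, `|det Φ'| = c⁻¹`) is a fibred change of
variables from `R'` onto `R''.constMul c`, and `[R''.constMul c] - c • [R'']` is fibred
(`of_constMul_nat_sub_nsmul_mem_fibredRelations`). [Kontsevich–Zagier 2001, §1.2 rules (1)–(2)]
[folklore] -/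
theorem exists_rep_of_sub_nsmul_of_mem_fibredRelations {N : ℕ} (c : ℕ) (hc : 0 < c)
    {R' : IntegralRep (N + 1 + 1)} {D'' : Set (Fin (N + 1 + 1) → ℝ)}
    {f : (Fin (N + 1 + 1) → ℝ) → ℝ} (hf1 : ∀ z a, f (Function.update z 1 a) = f z)
    (hR'i : ∀ z, R'.integrand z = f z)
    (hD'' : D'' = {z | Function.update z 1 ((c : ℝ) * z 1) ∈ R'.domain}) :
    ∃ R'' : IntegralRep (N + 1 + 1), R''.domain = D'' ∧ R''.integrand = f ∧
      of R' - c • of R'' ∈ fibredRelations := by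
  have hc0 : (0 : ℝ) < c := by exact_mod_cast hc
  have hcne : (c : ℝ) ≠ 0 := hc0.ne'
  -- `L z = update z 1 (c⁻¹ * z 1)`, `L.symm z = update z 1 (c * z 1)`, `det L = c⁻¹`
  obtain ⟨L, hL, hLs, hdet⟩ := exists_scaleEquiv (N + 1 + 1) 1 (inv_ne_zero hcne)
  simp only [inv_inv] at hLs
  -- the transported domain is semialgebraic, the integrand semialgebraic and integrable on it
  have hsa : IsSemialgebraic ℚ {z : Fin (N + 1 + 1) → ℝ | Function.update z 1 ((c : ℝ) * z 1) ∈
      R'.domain} := by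
    simpa only [Rat.cast_natCast] using
      isSemialgebraic_setOf_scale_mem R'.isSemialgebraic_domain 1 (c : ℚ)
  have hmaps : MapsTo (fun z : Fin (N + 1 + 1) → ℝ => Function.update z 1 ((c : ℝ) * z 1))
      {z | Function.update z 1 ((c : ℝ) * z 1) ∈ R'.domain} R'.domain := fun z hz => hz
  have hfi : IsSemialgebraicFunOn ℚ {z : Fin (N + 1 + 1) → ℝ | Function.update z 1 ((c : ℝ) * z 1) ∈
      R'.domain} f := by
    have hmap : IsSemialgebraicMapOn ℚ {z : Fin (N + 1 + 1) → ℝ | Function.update z 1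
        ((c : ℝ) * z 1) ∈ R'.domain} (fun z => Function.update z 1 ((c : ℝ) * z 1)) := by
      simpa only [Rat.cast_natCast] using isSemialgebraicMapOn_scale hsa 1 (c : ℚ)
    refine (IsSemialgebraicFunOn.comp_isSemialgebraicMapOn_holds R'.isSemialgebraicFunOn_integrand
      hmap hmaps).congr fun z _ => ?_
    rw [Function.comp_apply, hR'i, hf1]
  have hint : IntegrableOn f {z : Fin (N + 1 + 1) → ℝ | Function.update z 1 ((c : ℝ) * z 1) ∈
      R'.domain} volume := by
    have h := integrableOn_comp_equiv_preimage L.symm R'.integrableOn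
    have hfun : R'.integrand ∘ ⇑L.symm = f := funext fun z => by
      rw [Function.comp_apply, hLs, hR'i, hf1]
    have hset : ⇑L.symm ⁻¹' R'.domain = {z | Function.update z 1 ((c : ℝ) * z 1) ∈ R'.domain} :=
      Set.ext fun z => by rw [mem_preimage, hLs, mem_setOf_eq]
    rwa [hfun, hset] at h
  let R'' : IntegralRep (N + 1 + 1) :=
    { domain := D''
      integrand := f
      isSemialgebraic_domain := by rw [hD'']; exact hsa
      isSemialgebraicFunOn_integrand := by rw [hD'']; exact hfi
      integrableOn := by rw [hD'']; exact hint }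
  refine ⟨R'', rfl, rfl, ?_⟩
  -- the fibred change of variables `Φ = L` from `R'` onto `R''.constMul c`
  have hcov :
      of R' - of (R''.constMul (c : ℝ) (isAlgebraic_nat c)) ∈ fibredChangeOfVariablesRel := by
    refine of_sub_of_mem_fibredChangeOfVariablesRel (Φ := ⇑L)
      (Φ' := fun _ => (L : (Fin (N + 1 + 1) → ℝ) →L[ℝ] (Fin (N + 1 + 1) → ℝ))) ?_ ?_ ?_ ?_ ?_ ?_
    · refine (isSemialgebraicMapOn_scale R'.isSemialgebraic_domain 1 (c : ℚ)⁻¹).congr fun z _ => ?_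
      rw [hL, Rat.cast_inv, Rat.cast_natCast]
    · exact fun x _ => L.hasFDerivWithinAt
    · exact L.injective.injOn
    · show D'' = ⇑L '' R'.domain
      rw [hD'']
      ext z
      constructor
      · intro hz
        refine ⟨L.symm z, ?_, L.apply_symm_apply z⟩
        rw [hLs]
        exact hz
      · rintro ⟨y, hy, rfl⟩
        rw [mem_setOf_eq, ← hLs, L.symm_apply_apply]
        exact hy
    · intro x _
      rw [hdet, IntegralRep.integrand_constMul, abs_of_pos (inv_pos.mpr hc0), hL]
      show R'.integrand x = (c : ℝ) * f (Function.update x 1 ((c : ℝ)⁻¹ * x 1)) * (c : ℝ)⁻¹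
      rw [hf1, hR'i]
      field_simp
    · intro x _
      rw [hL, Function.update_of_ne Fin.zero_ne_one']
  have hsum : of R' - c • of R'' =
      (of R' - of (R''.constMul (c : ℝ) (isAlgebraic_nat c))) +
        (of (R''.constMul (c : ℝ) (isAlgebraic_nat c)) - c • of R'') := by
    abel
  rw [hsum]
  exact fibredRelations.add_mem (mem_fibredRelations_of_mem_fibredChangeOfVariablesRel hcov)
    (of_constMul_nat_sub_nsmul_mem_fibredRelations R'' c)

/-! ## The stub -/

/-- **Stub `stub_dilate_typedElementary`.** For a typed elementary family `R` (lower-bound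
coefficients `κ j`, exponents `e j`), a rational `0 < μ ≤ 1` and a natural `c > 0` with
`c ^ Q * μ ^ p = 1`, the slab restriction `R'` of the Jacobian-free dilate of `R` by `μ`
(`R'.domain = D_μ⁻¹(R.domain) ∩ {0 < z 0 < 1}`, `R'.integrand = R.integrand ∘ D_μ`) is, modulo
FIBRED relations, `c • [R'']` for the typed elementary family `R''` with lower-bound coefficients
`κ j * μ ^ (e j)`: `z = (s, u, t, w) ∈ R'.domain` iff `0 < s < 1`, `0 < u`,
`u ^ Q * μ ^ p * s ^ p < 1`, `κ j * μ ^ (e j) * s ^ (e j) ≤ t j ≤ 1`, `w ∈ r.domain`; the fibred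
substitution `u ↦ u / c` (`|det| = c⁻¹`, `(c u)^Q (μ s)^p = u^Q s^p`) carries `R'` onto
`R''.constMul c`, and `[R''.constMul c] - c • [R'']` is integrand additivity
(`exists_rep_of_sub_nsmul_of_mem_fibredRelations`). [Kontsevich–Zagier 2001, §1.2 rules (1)–(2)]
[folklore] -/
theorem stub_dilate_typedElementary : ∀ (Q p c B d : ℕ) (μ : ℚ) (κ : Fin B → ℚ) (e : Fin B → ℕ) (r : Literature.NumberTheory.Transcendental.KZ.IntegralRep d) (R R' : Literature.NumberTheory.Transcendental.KZ.IntegralRep (B + d + 1 + 1)), 0 < μ → μ ≤ 1 → 0 < c → (c : ℝ) ^ Q * (μ : ℝ) ^ p = 1 → R.domain = {z | ∃ (s u : ℝ) (t : Fin B → ℝ) (w : Fin d → ℝ), z = Matrix.vecCons s (Matrix.vecCons u (Fin.append t w)) ∧ 0 < s ∧ s < 1 ∧ 0 < u ∧ u ^ Q * s ^ p < 1 ∧ (∀ j, ((κ j : ℚ) : ℝ) * s ^ (e j) ≤ t j ∧ t j ≤ 1) ∧ w ∈ r.domain} → R.integrand = (fun z => (∏ j : Fin B, (z (Fin.castAdd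 d j).succ.succ)⁻¹) * r.integrand (fun l : Fin d => z (Fin.natAdd B l).succ.succ)) → R'.domain = {z | Function.update z 0 ((μ : ℝ) * z 0) ∈ R.domain} ∩ Literature.NumberTheory.Transcendental.KZ.paramSlab (B + d + 1) 0 1 → R'.integrand = (fun z => R.integrand (Function.update z 0 ((μ : ℝ) * z 0))) → ∃ R'' : Literature.NumberTheory.Transcendental.KZ.IntegralRep (B + d + 1 + 1), R''.domain = {z | ∃ (s u : ℝ) (t : Fin B → ℝ) (w : Fin d → ℝ), z = Matrix.vecCons s (Matrix.vecCons u (Fin.append t w)) ∧ 0 < s ∧ s < 1 ∧ 0 < u ∧ u ^ Q * s ^ p < 1 ∧ (∀ j, ((κ j * μ ^ (e j) : ℚ) : ℝ) * s ^ (e j) ≤ t j ∧ t j ≤ 1) ∧ w ∈ r.domain} ∧ R''.integrand = (fun z => (∏ j : Fin B, (z (Fin.castAdd d j).succ.succ)⁻¹) * r.integrand (fun l : Fin d => z (Fin.natAdd B l).succ.succ)) ∧ Literature.NumberTheory.Transcendental.KZ.of R' - c • Literature.NumberTheory.Transcendental.KZ.of R'' ∈ Literature.NumberTheory.Transcendental.KZ.fibredRelations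 := by
  intro Q p c B d μ κ e r R R' hμ hμ1 hc hcμ hR hRi hR' hR'i
  have hμ0 : (0 : ℝ) < μ := by exact_mod_cast hμ
  have hμ1' : (μ : ℝ) ≤ 1 := by exact_mod_cast hμ1
  have hc0 : (0 : ℝ) < c := by exact_mod_cast hc
  -- coordinate form of `R.domain`
  have hRc : R.domain = {z | 0 < z 0 ∧ z 0 < 1 ∧ 0 < z 1 ∧ z 1 ^ Q * z 0 ^ p < 1 ∧
      (∀ j : Fin B, ((κ j : ℚ) : ℝ) * z 0 ^ (e j) ≤ z (Fin.castAdd d j).succ.succ ∧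
        z (Fin.castAdd d j).succ.succ ≤ 1) ∧
      (fun l : Fin d => z (Fin.natAdd B l).succ.succ) ∈ r.domain} :=
    hR.trans (typedDomain_eq Q p B (fun j => ((κ j : ℚ) : ℝ)) e r)
  -- the integrand of `R'` is the typed integrand (which does not read the parameter)
  have hR'i' : ∀ z, R'.integrand z = (∏ j : Fin B, (z (Fin.castAdd d j).succ.succ)⁻¹) *
      r.integrand (fun l : Fin d => z (Fin.natAdd B l).succ.succ) := fun z => by
    rw [hR'i, hRi]
    exact typedIntegrand_update r (fun k => succ_succ_ne_zero k) z _
  -- the domain of `R''` is the transport of `R'.domain` through `u ↦ u / c`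
  have hkey : {z : Fin (B + d + 1 + 1) → ℝ | ∃ (s u : ℝ) (t : Fin B → ℝ) (w : Fin d → ℝ),
      z = Matrix.vecCons s (Matrix.vecCons u (Fin.append t w)) ∧ 0 < s ∧ s < 1 ∧ 0 < u ∧
        u ^ Q * s ^ p < 1 ∧ (∀ j, ((κ j * μ ^ (e j) : ℚ) : ℝ) * s ^ (e j) ≤ t j ∧ t j ≤ 1) ∧
        w ∈ r.domain} = {z | Function.update z 1 ((c : ℝ) * z 1) ∈ R'.domain} := by
    rw [typedDomain_eq Q p B (fun j => ((κ j * μ ^ (e j) : ℚ) : ℝ)) e r]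
    ext z
    have hpow : ((c : ℝ) * z 1) ^ Q * ((μ : ℝ) * z 0) ^ p = z 1 ^ Q * z 0 ^ p := by
      rw [mul_pow, mul_pow]
      calc (c : ℝ) ^ Q * z 1 ^ Q * ((μ : ℝ) ^ p * z 0 ^ p)
          = ((c : ℝ) ^ Q * (μ : ℝ) ^ p) * (z 1 ^ Q * z 0 ^ p) := by ring
        _ = z 1 ^ Q * z 0 ^ p := by rw [hcμ, one_mul]
    have hlow : ∀ j : Fin B, ((κ j : ℚ) : ℝ) * ((μ : ℝ) * z 0) ^ (e j) =
        ((κ j * μ ^ (e j) : ℚ) : ℝ) * z 0 ^ (e j) := fun j => by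
      push_cast
      ring
    simp only [mem_setOf_eq, hR', hRc, mem_inter_iff, mem_paramSlab, Rat.cast_zero, Rat.cast_one,
      Function.update_self, Function.update_of_ne (succ_succ_ne_zero _),
      Function.update_of_ne (succ_succ_ne_one _),
      Function.update_of_ne (Fin.zero_ne_one' (n := B + d + 1)),
      Function.update_of_ne (Fin.zero_ne_one' (n := B + d + 1)).symm, hpow, hlow]
    constructor
    · rintro ⟨h0, h1, hu, huq, ht, hw⟩
      exact ⟨⟨mul_pos hμ0 h0, mul_lt_one_of_nonneg_of_lt_one_right hμ1' h0.le h1, mul_pos hc0 hu,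
        huq, ht, hw⟩, h0, h1⟩
    · rintro ⟨⟨-, -, hu, huq, ht, hw⟩, h0, h1⟩
      exact ⟨h0, h1, (mul_pos_iff_of_pos_left hc0).mp hu, huq, ht, hw⟩
  obtain ⟨R'', hd, hi, hrel⟩ := exists_rep_of_sub_nsmul_of_mem_fibredRelations (N := B + d) c hc
    (R' := R') (f := fun z => (∏ j : Fin B, (z (Fin.castAdd d j).succ.succ)⁻¹) *
      r.integrand (fun l : Fin d => z (Fin.natAdd B l).succ.succ))
    (fun z a => typedIntegrand_update r (fun k => succ_succ_ne_one k) z a) hR'i' hkey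
  exact ⟨R'', hd, hi, hrel⟩

end Summit.KontsevichZagierPeriods.ValuedFieldSpecialisation
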